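import Literature.AlgebraicGeometry.Resolution.DiscInChart
import HarnessLib

/-!
# The `L₁`-rational cut-out of the disc: the sheet cutter in the form consumed by `RelCurveChart`

Topic: `Literature/AlgebraicGeometry/Resolution`. M. Temkin, *Inseparable local uniformization*,
J. Algebra 373 (2013) = arXiv:0804.1554v3, proof of Thm. 3.3.1, Step 3 (the refinement
`V = Spec(B)` by rational functions cutting out the disc component) — here for the chart datum
`RelCurveChart` (`RelativeCurveChartSetup.lean`, fields `gL, b, hbmemL, hbcutL, hvb`): for the
henselian generator `x ∈ L₁` and an `m`-rational disc `|X − a| ≤ |c|` whose `k`-conjugates of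
`a` lie in the Galois extension `M ⊇ m`, the conjugate-discs analysis (`ConjugateDiscs*.lean`,
`DiscInChart.lean`) provides the cut-out function `g = Q(x)^e/(ν · cNorm)` and the sheet cutter
`b = ∏_{far} (x − aᵢ)/(a − aᵢ)` with exactly the valuative properties the datum asks for:

* `sheetCutter_mem` — `b ∈ W` for every valuation ring `W ∋ x, g` inducing `V` on `M` — PROVED;
* `sheetCutter_cut` — if moreover `|b|_W = 1` then `|x − a|_W ≤ |c|_W` — PROVED.

The remaining field `hvb` (`|b|_V = 1`) is `ConjugateDiscs.valuation_conjProd_eq_one_of_le`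
(`ConjugateDiscs.lean`) applied to `hΔ : |x − a|_V ≤ |c|_V`; it needs none of the hypotheses
below (the former restatement `valuation_sheetCutter` was removed as a duplicate, 2026-08-15).

The hypotheses on the constants (`m ≤ M`, `M` integral over `m`, the height-one dichotomy for
valuation rings over `m°`, and "inducing `V ∩ m` on `m` ⇒ inducing `V` on `M`", which is
`mem_iff_mem_of_isGalois_of_forall_mem` of `UniqueExtensionBelowHenselization.lean`) are kept as
explicit premises. Everything is [folklore] bookkeeping over the cited files; no named facts.

## Sources

* M. Temkin, arXiv:0804.1554v3, proof of Thm. 3.3.1, Step 3 (p. 45); proof of Thm. 3.2.6,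
  Step 1 (p. 43).
-/

noncomputable section

open scoped BigOperators
open Polynomial

namespace Literature.AlgebraicGeometry.Resolution

namespace ConjugateDiscs

universe u

variable {Ω : Type u} [Field Ω] (V : ValuationSubring Ω) (M m : Subfield Ω)
variable {I : Type u} [Fintype I] (a : I → Ω) (i₀ : I) (c : Ω)

/-- **The sheet cutter at a valuation ring over `x, g` inducing `V` on `M`**: `b ∈ W` and
`b · (x − a)/c ∈ W`. (Instance of `conjProd_mem_and_mul_sub_div_mem` with `T = W`.) [folklore] -/
theorem sheetCutter_mem_and (hmM : m ≤ M) (ha : ∀ i, a i ∈ M) (hcM : c ∈ M)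
    (hc0 : c ≠ 0) (hcV : c ∈ V) (ha₀m : a i₀ ∈ m) (ha₀V : a i₀ ∈ V) (hcm : c ∈ m)
    (hArch : ∀ μ ∈ M, μ ∉ V → ∀ ν ∈ M, ∃ n : ℕ, ν * μ⁻¹ ^ n ∈ V)
    (hMint : ∀ W : ValuationSubring Ω, (∀ μ ∈ m, μ ∈ W) → ∀ μ ∈ M, μ ∈ W)
    (hmax : ∀ W : ValuationSubring Ω, (∀ μ ∈ m, μ ∈ V → μ ∈ W) →
      (∀ μ ∈ m, μ ∈ W) ∨ (∀ μ ∈ m, μ ∈ W ↔ μ ∈ V))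
    (hGal : ∀ W : ValuationSubring Ω, (∀ μ ∈ m, μ ∈ W ↔ μ ∈ V) → ∀ μ ∈ M, μ ∈ W ↔ μ ∈ V)
    {x g₁ ν : Ω} (hνM : ν ∈ M) (hνV : ν ∈ V)
    {e : ℕ} (he : e ≠ 0) (hgQ : g₁ * ν * cNorm V a i₀ c e = (∏ i, (x - a i)) ^ e)
    (hFm : ∀ j, (∏ i ∈ far V.valuation a i₀ (V.valuation c), (X - C (a i))).coeff j ∈ m)
    (hΔ : V.valuation (x - a i₀) ≤ V.valuation c)
    (W : ValuationSubring Ω) (hxW : x ∈ W) (hgW : g₁ ∈ W) (hWM : ∀ μ ∈ M, μ ∈ W ↔ μ ∈ V) :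
    conjProd V.valuation a i₀ (V.valuation c) x ∈ W ∧
      V.valuation (conjProd V.valuation a i₀ (V.valuation c) x) = 1 ∧
      conjProd V.valuation a i₀ (V.valuation c) x * ((x - a i₀) / c) ∈ W := by
  have h := conjProd_mem_and_mul_sub_div_mem V a i₀ c M m ha hcM hc0 hcV ha₀m ha₀V hcm hArch
    W.toSubring (fun μ hμm hμV => (hWM μ (hmM hμm)).mpr hμV) hxW hgW hνM hνV he hgQ hFm
    (fun z hz _ => hz W le_rfl)
    (fun W' hWW' => by
      have hmoW' : ∀ μ ∈ m, μ ∈ V → μ ∈ W' := fun μ hμm hμV =>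
        hWW' ((hWM μ (hmM hμm)).mpr hμV)
      rcases hmax W' hmoW' with h1 | h2
      · exact Or.inl (hMint W' h1)
      · exact Or.inr (hGal W' h2))
    hΔ
  exact h

/-- **`b ∈ W`** (field `hbmemL` of `RelCurveChart`). [folklore] -/
theorem sheetCutter_mem (hmM : m ≤ M) (ha : ∀ i, a i ∈ M) (hcM : c ∈ M)
    (hc0 : c ≠ 0) (hcV : c ∈ V) (ha₀m : a i₀ ∈ m) (ha₀V : a i₀ ∈ V) (hcm : c ∈ m)
    (hArch : ∀ μ ∈ M, μ ∉ V → ∀ ν ∈ M, ∃ n : ℕ, ν * μ⁻¹ ^ n ∈ V)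
    (hMint : ∀ W : ValuationSubring Ω, (∀ μ ∈ m, μ ∈ W) → ∀ μ ∈ M, μ ∈ W)
    (hmax : ∀ W : ValuationSubring Ω, (∀ μ ∈ m, μ ∈ V → μ ∈ W) →
      (∀ μ ∈ m, μ ∈ W) ∨ (∀ μ ∈ m, μ ∈ W ↔ μ ∈ V))
    (hGal : ∀ W : ValuationSubring Ω, (∀ μ ∈ m, μ ∈ W ↔ μ ∈ V) → ∀ μ ∈ M, μ ∈ W ↔ μ ∈ V)
    {x g₁ ν : Ω} (hνM : ν ∈ M) (hνV : ν ∈ V)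
    {e : ℕ} (he : e ≠ 0) (hgQ : g₁ * ν * cNorm V a i₀ c e = (∏ i, (x - a i)) ^ e)
    (hFm : ∀ j, (∏ i ∈ far V.valuation a i₀ (V.valuation c), (X - C (a i))).coeff j ∈ m)
    (hΔ : V.valuation (x - a i₀) ≤ V.valuation c)
    (W : ValuationSubring Ω) (hxW : x ∈ W) (hgW : g₁ ∈ W) (hWM : ∀ μ ∈ M, μ ∈ W ↔ μ ∈ V) :
    conjProd V.valuation a i₀ (V.valuation c) x ∈ W :=
  (sheetCutter_mem_and V M m a i₀ c hmM ha hcM hc0 hcV ha₀m ha₀V hcm hArch hMint hmax hGal hνM hνV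
    he hgQ hFm hΔ W hxW hgW hWM).1

/-- **`|b|_W = 1 ⇒ |x − a|_W ≤ |c|_W`** (field `hbcutL` of `RelCurveChart`). [folklore] -/
theorem sheetCutter_cut (hmM : m ≤ M) (ha : ∀ i, a i ∈ M) (hcM : c ∈ M)
    (hc0 : c ≠ 0) (hcV : c ∈ V) (ha₀m : a i₀ ∈ m) (ha₀V : a i₀ ∈ V) (hcm : c ∈ m)
    (hArch : ∀ μ ∈ M, μ ∉ V → ∀ ν ∈ M, ∃ n : ℕ, ν * μ⁻¹ ^ n ∈ V)
    (hMint : ∀ W : ValuationSubring Ω, (∀ μ ∈ m, μ ∈ W) → ∀ μ ∈ M, μ ∈ W)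
    (hmax : ∀ W : ValuationSubring Ω, (∀ μ ∈ m, μ ∈ V → μ ∈ W) →
      (∀ μ ∈ m, μ ∈ W) ∨ (∀ μ ∈ m, μ ∈ W ↔ μ ∈ V))
    (hGal : ∀ W : ValuationSubring Ω, (∀ μ ∈ m, μ ∈ W ↔ μ ∈ V) → ∀ μ ∈ M, μ ∈ W ↔ μ ∈ V)
    {x g₁ ν : Ω} (hνM : ν ∈ M) (hνV : ν ∈ V)
    {e : ℕ} (he : e ≠ 0) (hgQ : g₁ * ν * cNorm V a i₀ c e = (∏ i, (x - a i)) ^ e)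
    (hFm : ∀ j, (∏ i ∈ far V.valuation a i₀ (V.valuation c), (X - C (a i))).coeff j ∈ m)
    (hΔ : V.valuation (x - a i₀) ≤ V.valuation c)
    (W : ValuationSubring Ω) (hxW : x ∈ W) (hgW : g₁ ∈ W) (hWM : ∀ μ ∈ M, μ ∈ W ↔ μ ∈ V)
    (hWb : W.valuation (conjProd V.valuation a i₀ (V.valuation c) x) = 1) :
    W.valuation (x - a i₀) ≤ W.valuation c := by
  obtain ⟨-, -, h3⟩ := sheetCutter_mem_and V M m a i₀ c hmM ha hcM hc0 hcV ha₀m ha₀V hcm hArch hMint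
    hmax hGal hνM hνV he hgQ hFm hΔ W hxW hgW hWM
  have h4 : (x - a i₀) / c ∈ W := by
    have h5 := (W.valuation_le_one_iff _).mpr h3
    rw [map_mul, hWb, one_mul] at h5
    exact (W.valuation_le_one_iff _).mp h5
  have h6 := (W.valuation_le_one_iff _).mpr h4
  rw [map_div₀, div_le_one₀ ((Valuation.pos_iff _).mpr hc0)] at h6
  exact h6

end ConjugateDiscs

end Literature.AlgebraicGeometry.Resolution

end
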